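import Summits.HubbardSuperconductivity.HubbardSuperconductivity.Theorems.JmInterchange.Negative.AbstractWindowInterchangeFalse

/-!
# The abstract window double of `AbstractWindowInterchangeFalse`: isolation, zero-excess order of the excited branch,
and NO gain below the mesoscopic threshold (negative-side support for `JosephsonMirror.JmInterchange`, stmt-HubbardSuperconductivity-2227)

Companion to `Theorems/JmInterchange/Negative/AbstractWindowInterchangeFalse.lean` (same file-local toy: layer `ℂ⁴`,
`A = diag(0, 1, 0, 1)`, blocks `{e₀, e₁}` / `{e₂, e₃}`, pair operator `Δ_L = L² |e₃⟩⟨e₁|`, window double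
`H_L(J) = A ⊗ 1 + 1 ⊗ Aᵀ − J (D ⊗ D̄ + Dᴴ ⊗ D̄ᴴ)`, `D = L⁻¹ Δ_L`, in the crux's exact Kronecker/window/`minEnergyOn`
packaging).  That file proves the crux's gain hypothesis for the toy with pointwise onset and the vanishing of every
floor bridge.  This file records the three further properties quoted there:

* `aw_isolated₁`, `aw_isolated₂` : both floors are SIMPLE and ISOLATED by the gap `1` (`Re⟨v, A v⟩ ≥ (e + 1)‖v‖²`
  for block vectors orthogonal to the floor) — the two-sector isolation of the RATE-form interchange
  (`rateFormInterchange`, p129634) at the fixed scale `γ = 1`; so isolation at a fixed scale does not rescue the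
  FIXED-`J` interchange, only gain at mesoscopic couplings `J_L L²/γ_L → 0` does (and there the toy has none, below);
* `aw_excitedBranch_order` : the unit block-1 vector `e₁` has excess energy `1 = o(L²)` above its floor and pair
  intensity `‖Δ_L e₁‖² = L⁴` — ZERO-EXCESS PAIR ORDER in the sense of the crux's single-layer normal form
  (`hypGivesZEPO_of_pigeonhole` / `zepoGivesHyp`), carried by an excited branch while the floor is order-free
  (`aw_pairField_floor_eq_zero`): the (R1)-failure shape;
* `aw_noGain_of_small` : for `0 ≤ J`, `J L² ≤ 2` the window energy does not drop, `E_L(0) − E_L(J) ≤ 0`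
  (`Re⟨ψ, H_L(J) ψ⟩ ≥ (2 − J L²)(|ψ(1,1)|² + |ψ(3,3)|²) ≥ 0` for every two-layer `ψ`, and `E_L(0) ≤ 0` by the floor
  trial state `e₀ ⊗ e₀`).  With `aw_gain` the toy's gain profile is EXACTLY the retriage shape `max(0, J L² − 2)`:
  linear gain with pointwise onset `L₀(J)² ≍ 1/J` and NO uniform onset — the two sides of the crux's onset-upgrade
  normal form (`jmInterchange_iff_onsetUpgrade`, p137538) pulled apart in an abstract double.

Sources: E. H. Lieb, R. Seiringer, J. Yngvason, Rep. Math. Phys. 59 (2007) 389, p. 9 (the abstract obstruction to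
"SSB ⇒ condensation"); T. Koma, H. Tasaki, J. Stat. Phys. 76 (1994) 745; E. H. Lieb, PRL 62 (1989) 1201.
Elementary finite-dimensional linear algebra; no new definitions (file-local notation). [folklore]
-/

noncomputable section

namespace Summit.HubbardSuperconductivity.JmInterchangeNegative

open Matrix Literature.MathematicalPhysics.QuantumLattice
open Summit.HubbardSuperconductivity.HubbardSuperconductivity.Theorems.JosephsonMirror

/-- Toy layer Hamiltonian `diag(0, 1, 0, 1)` on `ℂ⁴` (as in `AbstractWindowInterchangeFalse`). -/
local notation "awA" => (Matrix.diagonal ![(0 : ℂ), 1, 0, 1] : Matrix (Fin 4) (Fin 4) ℂ)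
/-- Toy pair operator at side `L`: `Δ_L = L² |e₃⟩⟨e₁|`. -/
local notation "awΔ[" L "]" => (Matrix.single (3 : Fin 4) (1 : Fin 4) (((L : ℕ) : ℂ) ^ 2) : Matrix (Fin 4) (Fin 4) ℂ)
/-- Block-1 subspace (coordinates `0, 1`). -/
local notation "awK₁" => (⨅ (s : Fin 4) (_ : ¬ (s : ℕ) < 2),
  LinearMap.ker (LinearMap.proj (R := ℂ) (φ := fun _ : Fin 4 => ℂ) s) : Submodule ℂ (Fin 4 → ℂ))
/-- Block-2 subspace (coordinates `2, 3`). -/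
local notation "awK₂" => (⨅ (s : Fin 4) (_ : ¬ 2 ≤ (s : ℕ)),
  LinearMap.ker (LinearMap.proj (R := ℂ) (φ := fun _ : Fin 4 => ℂ) s) : Submodule ℂ (Fin 4 → ℂ))

/-! ### Isolation: simple floors with gap `1` -/

/-- A block-1 vector has `v 2 = v 3 = 0`. [folklore] -/
theorem aw_apply_eq_zero_of_mem_K₁ {v : Fin 4 → ℂ} (hv : v ∈ awK₁) : v 2 = 0 ∧ v 3 = 0 :=
  ⟨(aw_mem_K₁ v).1 hv 2 (by decide), (aw_mem_K₁ v).1 hv 3 (by decide)⟩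

/-- A block-2 vector has `v 0 = v 1 = 0`. [folklore] -/
theorem aw_apply_eq_zero_of_mem_K₂ {v : Fin 4 → ℂ} (hv : v ∈ awK₂) : v 0 = 0 ∧ v 1 = 0 :=
  ⟨(aw_mem_K₂ v).1 hv 0 (by decide), (aw_mem_K₂ v).1 hv 1 (by decide)⟩

/-- ISOLATION, block 1 (gap `1`, hence a SIMPLE floor `ℂ e₀`): a block-1 vector orthogonal to the floor `e₀` has
`Re⟨v, A v⟩ ≥ (0 + 1) ‖v‖²`. [folklore] -/
theorem aw_isolated₁ {v : Fin 4 → ℂ} (hv : v ∈ awK₁) (h0 : star (Pi.single (0 : Fin 4) (1 : ℂ)) ⬝ᵥ v = 0) :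
    ((awA).minEnergyOn awK₁ + 1) * (star v ⬝ᵥ v).re ≤ (star v ⬝ᵥ awA *ᵥ v).re := by
  rw [aw_minEnergyOn_block₁, aw_re_rayleigh, aw_re_star_dotProduct_self]
  rw [← Pi.single_star, star_one, single_dotProduct, one_mul] at h0
  obtain ⟨h2, h3⟩ := aw_apply_eq_zero_of_mem_K₁ hv
  rw [h0, h2, h3]
  simp

/-- ISOLATION, block 2 (gap `1`, simple floor `ℂ e₂`): a block-2 vector orthogonal to `e₂` has
`Re⟨v, A v⟩ ≥ (0 + 1) ‖v‖²`. [folklore] -/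
theorem aw_isolated₂ {v : Fin 4 → ℂ} (hv : v ∈ awK₂) (h2 : star (Pi.single (2 : Fin 4) (1 : ℂ)) ⬝ᵥ v = 0) :
    ((awA).minEnergyOn awK₂ + 1) * (star v ⬝ᵥ v).re ≤ (star v ⬝ᵥ awA *ᵥ v).re := by
  rw [aw_minEnergyOn_block₂, aw_re_rayleigh, aw_re_star_dotProduct_self]
  rw [← Pi.single_star, star_one, single_dotProduct, one_mul] at h2
  obtain ⟨h0, h1⟩ := aw_apply_eq_zero_of_mem_K₂ hv
  rw [h2, h0, h1]
  simp

/-! ### Zero-excess pair order of the excited branch -/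

/-- ZERO-EXCESS PAIR ORDER of the excited branch: the unit block-1 vector `e₁` has excess energy `1` above the
block-1 floor (`= o(L²)`) and pair intensity `‖Δ_L e₁‖² = L⁴`. [folklore] -/
theorem aw_excitedBranch_order (L : ℕ) :
    Pi.single (1 : Fin 4) (1 : ℂ) ∈ awK₁ ∧ star (Pi.single (1 : Fin 4) (1 : ℂ)) ⬝ᵥ Pi.single (1 : Fin 4) (1 : ℂ) = 1 ∧
      (star (Pi.single (1 : Fin 4) (1 : ℂ)) ⬝ᵥ awA *ᵥ Pi.single (1 : Fin 4) (1 : ℂ)).re =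
        (awA).minEnergyOn awK₁ + 1 ∧
      (star (awΔ[L] *ᵥ Pi.single (1 : Fin 4) (1 : ℂ)) ⬝ᵥ (awΔ[L] *ᵥ Pi.single (1 : Fin 4) (1 : ℂ))).re =
        (L : ℝ) ^ 4 := by
  refine ⟨aw_single_mem_K₁ (by decide), aw_single_unit 1, ?_, ?_⟩
  · rw [aw_re_rayleigh_single, aw_minEnergyOn_block₁]
    simp
  · rw [aw_pairField_mulVec, star_smul, smul_dotProduct, dotProduct_smul, aw_single_unit, Pi.single_eq_same, mul_one]
    simp only [smul_eq_mul, mul_one]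
    rw [Complex.star_def, Complex.conj_mul', ← Complex.ofReal_pow, Complex.ofReal_re, norm_pow, Complex.norm_natCast]
    ring

/-! ### No gain below the mesoscopic threshold: the onset is genuinely `J`-dependent -/

/-- The rescaled toy pair operator `D = L⁻¹ Δ_L = L |e₃⟩⟨e₁|`. [folklore] -/
theorem aw_D_eq (L : ℕ) [NeZero L] :
    ((L : ℂ))⁻¹ • awΔ[L] = Matrix.single (3 : Fin 4) (1 : Fin 4) (L : ℂ) := by
  rw [smul_single, smul_eq_mul]
  congr 1
  have hL : (L : ℂ) ≠ 0 := Nat.cast_ne_zero.2 (NeZero.ne L)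
  field_simp

/-- The toy's Josephson coupling `K = D ⊗ D̄ + Dᴴ ⊗ D̄ᴴ` in coordinates:
`K = L² (|e₍₃,₃₎⟩⟨e₍₁,₁₎| + |e₍₁,₁₎⟩⟨e₍₃,₃₎|)`. [folklore] -/
theorem aw_coupling_eq (L : ℕ) [NeZero L] :
    (let D : Matrix (Fin 4) (Fin 4) ℂ := ((L : ℂ))⁻¹ • awΔ[L]
     Matrix.kroneckerMap (fun a b : ℂ => a * b) D (Matrix.transpose (Matrix.conjTranspose D)) +
        Matrix.kroneckerMap (fun a b : ℂ => a * b) (Matrix.conjTranspose D) (Matrix.transpose D) =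
      Matrix.single ((3 : Fin 4), (3 : Fin 4)) ((1 : Fin 4), (1 : Fin 4)) ((L : ℂ) * L) +
        Matrix.single ((1 : Fin 4), (1 : Fin 4)) ((3 : Fin 4), (3 : Fin 4)) ((L : ℂ) * L)) := by
  intro D
  have hD : D = Matrix.single (3 : Fin 4) (1 : Fin 4) (L : ℂ) := aw_D_eq L
  have hstar : star (L : ℂ) = L := Complex.conj_natCast L
  rw [hD, conjTranspose_single, hstar, transpose_single, transpose_single,
    kroneckerMap_single_single _ _ _ _ _ (fun b => zero_mul b) (fun a => mul_zero a),
    kroneckerMap_single_single _ _ _ _ _ (fun b => zero_mul b) (fun a => mul_zero a)]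

/-- The toy's Josephson coupling is bounded by the diagonal window weights:
`Re⟨ψ, K ψ⟩ = 2L² Re(ψ(1,1) conj ψ(3,3)) ≤ L² (|ψ(1,1)|² + |ψ(3,3)|²)`. [folklore] -/
theorem aw_re_coupling_le (L : ℕ) [NeZero L] (ψ : Fin 4 × Fin 4 → ℂ) :
    (let D : Matrix (Fin 4) (Fin 4) ℂ := ((L : ℂ))⁻¹ • awΔ[L]
     (star ψ ⬝ᵥ (Matrix.kroneckerMap (fun a b : ℂ => a * b) D (Matrix.transpose (Matrix.conjTranspose D)) +
        Matrix.kroneckerMap (fun a b : ℂ => a * b) (Matrix.conjTranspose D) (Matrix.transpose D)) *ᵥ ψ).re ≤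
      (L : ℝ) ^ 2 * (‖ψ (1, 1)‖ ^ 2 + ‖ψ (3, 3)‖ ^ 2)) := by
  have hK := aw_coupling_eq L
  simp only at hK ⊢
  rw [hK, add_mulVec, Matrix.single_mulVec_eq, Matrix.single_mulVec_eq, dotProduct_add, dotProduct_smul,
    dotProduct_smul, dotProduct_single, dotProduct_single]
  simp only [Pi.star_apply, mul_one, smul_eq_mul, Complex.add_re, Complex.star_def]
  have h1 : ((L : ℂ) * L * ψ (1, 1) * (starRingEnd ℂ) (ψ (3, 3))).re =
      (L : ℝ) ^ 2 * ((ψ (1, 1)).re * (ψ (3, 3)).re + (ψ (1, 1)).im * (ψ (3, 3)).im) := by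
    simp [Complex.mul_re, Complex.mul_im]
    ring
  have h2 : ((L : ℂ) * L * ψ (3, 3) * (starRingEnd ℂ) (ψ (1, 1))).re =
      (L : ℝ) ^ 2 * ((ψ (1, 1)).re * (ψ (3, 3)).re + (ψ (1, 1)).im * (ψ (3, 3)).im) := by
    simp [Complex.mul_re, Complex.mul_im]
    ring
  rw [h1, h2, Complex.sq_norm, Complex.sq_norm, Complex.normSq_apply, Complex.normSq_apply]
  nlinarith [sq_nonneg ((ψ (1, 1)).re - (ψ (3, 3)).re), sq_nonneg ((ψ (1, 1)).im - (ψ (3, 3)).im),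
    pow_nonneg (Nat.cast_nonneg (α := ℝ) L) 2]

/-- The decoupled toy double `A ⊗ 1 + 1 ⊗ Aᵀ` in coordinates (columns and rows):
`Re⟨ψ, (A ⊗ 1 + 1 ⊗ Aᵀ) ψ⟩ = Σ_t (|ψ(1,t)|² + |ψ(3,t)|²) + Σ_s (|ψ(s,1)|² + |ψ(s,3)|²)`. [folklore] -/
theorem aw_re_double_eq (ψ : Fin 4 × Fin 4 → ℂ) :
    (star ψ ⬝ᵥ (Matrix.kroneckerMap (fun a b : ℂ => a * b) awA 1 +
        Matrix.kroneckerMap (fun a b : ℂ => a * b) 1 (Matrix.transpose awA)) *ᵥ ψ).re =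
      (∑ t : Fin 4, (‖ψ (1, t)‖ ^ 2 + ‖ψ (3, t)‖ ^ 2)) + ∑ s : Fin 4, (‖ψ (s, 1)‖ ^ 2 + ‖ψ (s, 3)‖ ^ 2) := by
  rw [diagonal_transpose, add_mulVec, dotProduct_add, Complex.add_re]
  have hc := star_dotProduct_kronecker_one_mulVec awA ψ
  have hr := star_dotProduct_one_kronecker_mulVec awA ψ
  rw [hc, hr, Complex.re_sum, Complex.re_sum]
  simp only [aw_re_rayleigh]

/-- Lower bound for the decoupled toy double by the two diagonal window weights:
`2 (|ψ(1,1)|² + |ψ(3,3)|²) ≤ Re⟨ψ, (A ⊗ 1 + 1 ⊗ Aᵀ) ψ⟩`. [folklore] -/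
theorem aw_re_double_ge (ψ : Fin 4 × Fin 4 → ℂ) :
    2 * (‖ψ (1, 1)‖ ^ 2 + ‖ψ (3, 3)‖ ^ 2) ≤
      (star ψ ⬝ᵥ (Matrix.kroneckerMap (fun a b : ℂ => a * b) awA 1 +
        Matrix.kroneckerMap (fun a b : ℂ => a * b) 1 (Matrix.transpose awA)) *ᵥ ψ).re := by
  rw [aw_re_double_eq, Fin.sum_univ_four, Fin.sum_univ_four]
  nlinarith [sq_nonneg ‖ψ (1, 0)‖, sq_nonneg ‖ψ (3, 0)‖, sq_nonneg ‖ψ (3, 1)‖, sq_nonneg ‖ψ (1, 2)‖,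
    sq_nonneg ‖ψ (3, 2)‖, sq_nonneg ‖ψ (1, 3)‖, sq_nonneg ‖ψ (0, 1)‖, sq_nonneg ‖ψ (0, 3)‖,
    sq_nonneg ‖ψ (2, 1)‖, sq_nonneg ‖ψ (2, 3)‖, sq_nonneg ‖ψ (3, 1)‖, sq_nonneg ‖ψ (1, 3)‖]

/-- Below the mesoscopic threshold the toy window double is nonnegative: for `0 ≤ J`, `J L² ≤ 2` and every
two-layer vector `ψ`, `0 ≤ Re⟨ψ, H_L(J) ψ⟩` (`≥ (2 − J L²)(|ψ(1,1)|² + |ψ(3,3)|²)`). [folklore] -/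
theorem aw_rayleigh_double_nonneg_of_small (L : ℕ) [NeZero L] {J : ℝ} (hJ : 0 ≤ J)
    (hJL : J * (L : ℝ) ^ 2 ≤ 2) (ψ : Fin 4 × Fin 4 → ℂ) :
    (let D : Matrix (Fin 4) (Fin 4) ℂ := ((L : ℂ))⁻¹ • awΔ[L]
     0 ≤ (star ψ ⬝ᵥ (Matrix.kroneckerMap (fun a b : ℂ => a * b) awA 1 +
         Matrix.kroneckerMap (fun a b : ℂ => a * b) 1 (Matrix.transpose awA) -
         (J : ℂ) • (Matrix.kroneckerMap (fun a b : ℂ => a * b) D (Matrix.transpose (Matrix.conjTranspose D)) +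
           Matrix.kroneckerMap (fun a b : ℂ => a * b) (Matrix.conjTranspose D) (Matrix.transpose D))) *ᵥ ψ).re) := by
  intro D
  have hsplit := re_rayleigh_windowDouble awA D J ψ
  rw [hsplit]
  have h₀ := aw_re_double_ge ψ
  have hK := aw_re_coupling_le L ψ
  simp only at hK
  have hX : 0 ≤ ‖ψ (1, 1)‖ ^ 2 + ‖ψ (3, 3)‖ ^ 2 := by positivity
  have hJK : J * (star ψ ⬝ᵥ (Matrix.kroneckerMap (fun a b : ℂ => a * b) D Dᴴᵀ +
      Matrix.kroneckerMap (fun a b : ℂ => a * b) Dᴴ Dᵀ) *ᵥ ψ).re ≤ 2 * (‖ψ (1, 1)‖ ^ 2 + ‖ψ (3, 3)‖ ^ 2) :=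
    calc J * (star ψ ⬝ᵥ (Matrix.kroneckerMap (fun a b : ℂ => a * b) D Dᴴᵀ +
          Matrix.kroneckerMap (fun a b : ℂ => a * b) Dᴴ Dᵀ) *ᵥ ψ).re
          ≤ J * ((L : ℝ) ^ 2 * (‖ψ (1, 1)‖ ^ 2 + ‖ψ (3, 3)‖ ^ 2)) := mul_le_mul_of_nonneg_left hK hJ
      _ = (J * (L : ℝ) ^ 2) * (‖ψ (1, 1)‖ ^ 2 + ‖ψ (3, 3)‖ ^ 2) := by ring
      _ ≤ 2 * (‖ψ (1, 1)‖ ^ 2 + ‖ψ (3, 3)‖ ^ 2) := mul_le_mul_of_nonneg_right hJL hX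
  linarith

/-- **No gain below the mesoscopic threshold**: for `0 ≤ J` with `J L² ≤ 2` the toy's window energy does not drop,
`E_L(0) − E_L(J) ≤ 0` (`E_L(J) ≥ 0` by `aw_rayleigh_double_nonneg_of_small`, `E_L(0) ≤ 0` by the floor trial state
`e₀ ⊗ e₀`).  So the toy's gain profile is the retriage shape `max(0, J L² − 2)`: linear gain with POINTWISE onset
`L₀(J)² ≥ 4/J` (`aw_gainHyp`) and NO uniform onset — the two halves of the crux's onset-upgrade normal form
(`jmInterchange_iff_onsetUpgrade`, p137538) pulled apart. [folklore] -/
theorem aw_noGain_of_small (L : ℕ) [NeZero L] {J : ℝ} (hJ : 0 ≤ J) (hJL : J * (L : ℝ) ^ 2 ≤ 2) :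
    (let D : Matrix (Fin 4) (Fin 4) ℂ := ((L : ℂ))⁻¹ • awΔ[L]
     let Hd : ℝ → Matrix (Fin 4 × Fin 4) (Fin 4 × Fin 4) ℂ := fun J =>
       Matrix.kroneckerMap (fun a b : ℂ => a * b) awA 1 +
         Matrix.kroneckerMap (fun a b : ℂ => a * b) 1 (Matrix.transpose awA) -
         (J : ℂ) • (Matrix.kroneckerMap (fun a b : ℂ => a * b) D (Matrix.transpose (Matrix.conjTranspose D)) +
           Matrix.kroneckerMap (fun a b : ℂ => a * b) (Matrix.conjTranspose D) (Matrix.transpose D))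
     let good : Fin 4 × Fin 4 → Prop := fun p =>
       ((p.1 : ℕ) < 2 ∧ (p.2 : ℕ) < 2) ∨ (2 ≤ (p.1 : ℕ) ∧ 2 ≤ (p.2 : ℕ))
     let S : Submodule ℂ (Fin 4 × Fin 4 → ℂ) := ⨅ (p : Fin 4 × Fin 4) (_ : ¬ good p),
       LinearMap.ker (LinearMap.proj (R := ℂ) (φ := fun _ : Fin 4 × Fin 4 => ℂ) p)
     let E : ℝ → ℝ := fun J => (Hd J).minEnergyOn S
     E 0 - E J ≤ 0) := by
  intro D Hd good S E
  have hS : ∀ ψ, ψ ∈ S ↔ ∀ p, ¬ good p → ψ p = 0 := by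
    intro ψ
    simp only [S, Submodule.mem_iInf, LinearMap.mem_ker, LinearMap.proj_apply]
  -- the floor trial state `e₀ ⊗ e₀`
  set ψ₀ : Fin 4 × Fin 4 → ℂ := Pi.single ((0 : Fin 4), (0 : Fin 4)) (1 : ℂ) with hψ₀
  have hψ₀S : ψ₀ ∈ S := by
    rw [hS]
    intro p hp
    rw [hψ₀, Pi.single_apply, if_neg]
    rintro rfl
    exact hp (Or.inl ⟨by decide, by decide⟩)
  have hψ₀1 : star ψ₀ ⬝ᵥ ψ₀ = 1 := by
    rw [hψ₀, ← Pi.single_star, star_one, single_dotProduct, one_mul, Pi.single_eq_same]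
  -- `E J ≥ 0`
  have hEJ : 0 ≤ E J :=
    aw_le_minEnergyOn (Hd J) S hψ₀S hψ₀1 fun ψ _ _ => aw_rayleigh_double_nonneg_of_small L hJ hJL ψ
  -- `E 0 ≤ 0`
  have hherm : (Hd 0).IsHermitian := isHermitian_windowDouble aw_isHermitian D 0
  have hE0 : E 0 ≤ 0 := by
    refine (minEnergyOn_le_rayleigh_of_mem hherm S hψ₀S hψ₀1).trans (le_of_eq ?_)
    have hsplit := re_rayleigh_windowDouble awA D 0 ψ₀
    show (star ψ₀ ⬝ᵥ (Hd 0) *ᵥ ψ₀).re = 0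
    rw [hsplit, zero_mul, sub_zero, aw_re_double_eq, Fin.sum_univ_four, Fin.sum_univ_four]
    simp [hψ₀]
  linarith


end Summit.HubbardSuperconductivity.JmInterchangeNegative

end
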